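import Summits.QuantumFields.YangMills.Theorems.BalabanUVNodesN20AtSpineCarriers
import Summits.QuantumFields.YangMills.Theorems.BalabanUVNodesN27SpineRecordJoinNonDegenerate
import Literature.MathematicalPhysics.QuantumFieldTheory.Balaban1983to89.Node00.Record11

/-!
# YM-DAG node N20 (= NE7b) AT NODE 00's STAGE-11 RECORD `Node00.IsRecordOfRecord₁₁C` (`Node00/Record11.lean`, p444286): the K5 stub
# `YMDAG.UVSplit.S_N20 SRec` for spine-carrier predicates TYPED OVER THE ₁₁ RECORD — the ₁₁ successor of `BalabanUVNodesN20AtSpineCarriers` (p421432)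

Track A of `YM-PLAN.md` (cell `pub-ymgap`, HUMAN RULING D-0062), node **N20**; R134 fan-out seat `pub-ymgap-dag-n20-e` (strategy s2 = BY-NAME KNIT at
the ₁₁ record; dag-lead FAN-OUT v1.1 §N20 s2 «re-key `…N20AtSpineCarriers` closers at ₁₁ ∕ the rate-record home»).  Kernel bookkeeping BY NAME: 0 `def`,
0 `sorry`, standard axioms.  COUNT-NEUTRAL; `--supports` the K3 item `SpineGivenEndpointR11` (stmt-QuantumFields-19676) of route `BalabanUVNodes` rev 6,
which quantifies over `Node00.IsRecordOfRecord₁₁C F 2 D w`.  Restate-immune (neither the Theses file nor any ∃-currency module imported).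

THE POINT.  `S_N20 SRec := ∀ F D g₀ os S, SRec F D g₀ os S → T4WeightBudget.RelWeightBound S.l₀ S.T S.A S.B S.Bad S.W` reads the record ONLY through
the SET OF BUNDLES `SRec` pins (§1 `s_N20_iff_forall_pinned`: N20 is DATUM-BLIND — `RelWeightBound` mentions no field of `D`).  At Stage 11 a record pair
is `(D, w)` with `D = Node00.datumOfRecord₁₁ F N θ hP` for an ADMISSIBLE `θ : Node00.Stage11Params F N` WITH ITS DISPLAYED PROVISOS `hP : θ.Provisos₁₁`
(`Node00.IsRecordOfRecord₁₁C`, `Node00.exists_provisos_of_isRecordOfRecord₁₁C`).  A spine-carrier predicate TYPED OVER ₁₁C hands, with every bundle it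
pins, such a witness realising the datum; a predicate KEYED at ₁₁ by a reading `cr : (F, θ, hP, g₀, os) ↦ SpineCarriers` pins exactly the bundles
`cr F θ hP g₀ os` at `datumOfRecord₁₁ F N θ hP`.  NO `Node00/` HOME of the spine carriers exists today (dag-lead FAN-OUT v1.1 roll-up row 1: «RATE-RECORD
HOME … NO»): the reading `cr` is a PARAMETER of every statement below, exactly as `SRec` is a parameter of the cut (`BalabanUVNodesClustersCore`); when
the definer lands it, instantiation is a substitution.

WHAT THIS MODULE PROVES.
* §1 READINGS: `s_N20_iff_forall_pinned` (datum-blind) · `s_N20_of_image` (IMAGE-antitone re-key: fewer pinned bundles ⇒ easier; contains XII's pointwise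
  `BalabanUVNodesN27SpineRecord.s_N20_antitone`) · **`s_N20_keyed₁₁_iff`** (THE RE-KEY: at a predicate keyed at ₁₁ by `cr`, `S_N20` ⟺ «NE7b's
  `RelWeightBound` at `cr F θ hP g₀ os` for EVERY family, EVERY admissible Stage-11 `θ` with provisos, every tuned bare sequence `g₀` and loop string
  `os`» — a statement about NODE 00's parameter tuples, nothing else) · `s_N20_of_stage11_slot` (the one-application closer for an `SRec` typed over ₁₁C,
  twin of n17-a's `s_N17_of_stage9_slot`).
* §2 CLOSERS RE-KEYED OVER θ, BY NAME (dag-n20-a's producers `N20Knit.relWeightBound_of_extractionLaws ∕ _majorant ∕ _mono_weight`):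
  `s_N20_keyed₁₁_of_extractionLaws` (two runs' `PinnedExtraction.ExtractionLaws` + the count at the reading's exact carriers), `s_N20_keyed₁₁_of_majorant`
  (two-rate majorant `V·r^{K − j⋆ K}` as the slot), `s_N20_keyed₁₁_of_weightSlot` (the reading's `W` a pinned majorant of a witness weight).
* §3 WHERE THE ₁₁ OBJECTS ENTER N20 — THE E1∕E2 DICTIONARY AT THE ₁₁ DATUM: `schemeZ_pos_datumOfRecord₁₁` (HYPOTHESIS-FREE at ₁₁: the dressed partition
  functions of the Wilson scheme of `datumOfRecord₁₁ F N θ hP` — generated by the densities of record `densOfRecord₁₀` — are positive; B1 by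
  `Node00.isPrintedAveraged_datumOfRecord₁₁`, then `BalabanUVNodesN27SpineRecord.schemeZ_scheme_pos`) · `badWeight_le_schemeZ_datumOfRecord₁₁_left ∕ _right`
  (NE7b's inequality AS THE ₁₁ SENTENCE: under E1 ∕ E2 the persistent-activity classes carry at most `S.W K` of the string's dressed partition function of
  record after `S.K₀ + K` ∕ `S.K₀ + K + 1` steps) · `goodTotal_pos_datumOfRecord₁₁` · `classes_nonempty_datumOfRecord₁₁` (n27-a's A2 audit
  `goodTotal_pos_of_E1` ∕ `classes_nonempty_of_E1` with `D.AvgMeasurable` DISCHARGED at ₁₁ — an E1-pinned bundle at a ₁₁ datum is never the empty or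
  weightless expansion, so of p421432's guards only the bad-class traps remain relevant for the ₁₁ definer).
* §4 NON-VACUITY ⟺ K0's BODY AT `N`: `s_N20_keyed₁₁_of_uninhabited` (if NO admissible Stage-11 θ satisfies its provisos on any family, a predicate typed over
  ₁₁C pins nothing and `S_N20` is FREE — `N20AtSpineCarriers.s_N20_of_empty`) · `exists_pinned_keyed₁₁_of_inhabited` (conversely, under the body of K0
  `Record11Inhabited` at `N` — `∀ F, ∃ D w, IsRecordOfRecord₁₁C F N D w`, NEITHER PROVED NOR ASSUMED beyond this implication — a keyed predicate pins on every
  family, for every `(g₀, os)`, a bundle at a ₁₁ datum: the stub is NOT the empty implication) · `relWeightBound_keyed₁₁_of_isRecordOfRecord₁₁C` (the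
  consumer face AT A ₁₁ RECORD PAIR: a pinned bundle with NE7b at the pair's own datum, for every `(g₀, os)` — what the ₁₁ join of N27 consumes next to `S_N27x`).
* §5 SHADOW: `s_N20_keyed₁₁_iff_shadow₅` — the same reading re-keyed to def-T's ₅C SHADOW datum `datumOfRecord₅ F N (shadow₅OfRecord₁₁ F N θ hP γ')`
  (`Record11` §8: same `C`, `dens`, `βfun`, `av`; the ₁₁ → ₅C refinement holds AT THE SHADOW, not at `D`) gives THE SAME `S_N20` — N20 transfers along
  `Node00.exists_isRecordOfRecord₅C_of_isRecordOfRecord₁₁C` for free (datum-blindness; N27's B5 needs `b5_congr`, N20 needs nothing).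

HONEST FRAMING.  NE7b is NOT PRINTED ([Balaban1989LargeFieldII] (1.79)–(1.89) pp. 383–387 display the KIND of extraction per pinned old genealogy for ONE
run; the summable relative COUNT is the cell's) and NOT PROVED; no inhabitant of `IsRecordOfRecord₁₁C` is claimed (K0 open); no reading `cr` of Bałaban's
history expansion off `θ` exists in the tree ((A1c) object; NC-NE7b-α UNRULED); every extraction law, count and majorant below is a HYPOTHESIS on the
reading; nothing of Bałaban's is asserted or instantiated; N20 is NOT discharged (0∕1 at every record); typed 28∕28, discharged count untouched; one finite
four-torus programme at fixed `ε` — NOT ℝ⁴, NOT infinite volume, NOT OS, NOT a mass gap, NOT Clay.  No decl below carries a cite tag.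
-/

open Finset

namespace Summit.QuantumFields.YangMills.Theorems.N20AtRecord11

open Literature.MathematicalPhysics.QuantumFieldTheory.Balaban1983to89
open Literature.MathematicalPhysics.QuantumFieldTheory.Balaban1983to89.T4Continuum
open T4WeightBudget (RelWeightBound)
open Summit.QuantumFields.BalabanUV.T4Continuum.NE7b.PinnedExtraction (ExtractionLaws)
open Summit.QuantumFields.YangMills.BalabanUVNodes.N20Knit (relWeightBound_of_extractionLaws relWeightBound_of_extractionLaws_majorant
  relWeightBound_mono_weight)
open Summit.QuantumFields.YangMills.Theorems.N20AtSpineCarriers (s_N20_of_empty)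
open Summit.QuantumFields.YangMills.Theorems.BalabanUVNodesN27SpineRecord (schemeZ_scheme_pos goodTotal_pos_of_E1 classes_nonempty_of_E1)
open YMDAG.UVSplit (Datum SpineCarriers SpineRecordPred S_N20)
open Node00 (Stage11Params datumOfRecord₁₁ IsRecordOfRecord₁₁C)

variable {N : ℕ} [NeZero N]

/-! ## §1 Readings: N20 is datum-blind; the image re-key; `S_N20` at a predicate KEYED at the ₁₁ record -/

/-- **N20 IS DATUM-BLIND.**  `S_N20 SRec` holds iff NE7b's `RelWeightBound` holds at EVERY bundle that `SRec` pins somewhere — the datum `D`, the bare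
sequence `g₀` and the string `os` enter only through WHICH bundles are pinned (`RelWeightBound S.l₀ S.T S.A S.B S.Bad S.W` reads no field of `D`).
[bookkeeping] -/
theorem s_N20_iff_forall_pinned (SRec : SpineRecordPred N) :
    S_N20 SRec ↔ ∀ S : SpineCarriers,
      (∃ (F : T4Family) (D : Datum F N) (g₀ : ℕ → ℝ) (os : List (ULoop F)), SRec F D g₀ os S) →
        RelWeightBound S.l₀ S.T S.A S.B S.Bad S.W :=
  ⟨fun h S ⟨F, D, g₀, os, hS⟩ => h F D g₀ os S hS, fun h F D g₀ os S hS => h S ⟨F, D, g₀, os, hS⟩⟩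

/-- **THE IMAGE RE-KEY (antitone in the set of pinned bundles).**  If every bundle `SRec'` pins somewhere is pinned somewhere by `SRec` (possibly at
another family, datum, sequence or string), then `S_N20 SRec → S_N20 SRec'`.  Contains XII's pointwise `BalabanUVNodesN27SpineRecord.s_N20_antitone`;
it is what lets a reading be moved between a ₁₁ datum and its ₅C shadow (§5) at no cost. [bookkeeping] -/
theorem s_N20_of_image {SRec SRec' : SpineRecordPred N}
    (himg : ∀ S : SpineCarriers,
      (∃ (F : T4Family) (D : Datum F N) (g₀ : ℕ → ℝ) (os : List (ULoop F)), SRec' F D g₀ os S) →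
        ∃ (F : T4Family) (D : Datum F N) (g₀ : ℕ → ℝ) (os : List (ULoop F)), SRec F D g₀ os S)
    (h : S_N20 SRec) : S_N20 SRec' := by
  rw [s_N20_iff_forall_pinned] at h ⊢
  exact fun S hS => h S (himg S hS)

section Keyed

-- `cr`: a READING of spine carriers off NODE 00's Stage-11 parameter tuples with provisos (a PARAMETER of this module: no such reading of
-- Bałaban's history expansion exists in the tree).
variable (cr : (F : T4Family) → (θ : Stage11Params F N) → θ.Provisos₁₁ → (ℕ → ℝ) → List (ULoop F) → SpineCarriers)

/-- **THE RE-KEY AT ₁₁.**  Let `SRec` be KEYED at the Stage-11 record by the reading `cr`: it pins, at `(F, D, g₀, os)`, exactly the bundles `cr F θ hP g₀ os`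
of the ADMISSIBLE Stage-11 parameter tuples `θ` WITH PROVISOS `hP` whose datum of record IS `D` (`D = Node00.datumOfRecord₁₁ F N θ hP` — the datum clause of
`Node00.IsRecordOfRecord₁₁C`).  Then `S_N20 SRec` is EXACTLY the statement «for every family, every admissible Stage-11 `θ` with its provisos, every bare
sequence `g₀` and every loop string `os`, NE7b's `RelWeightBound` holds at the carriers `cr F θ hP g₀ os`» — N20 as a property of NODE 00's objects of record.
[bookkeeping] -/
theorem s_N20_keyed₁₁_iff (SRec : SpineRecordPred N)
    (hkey : ∀ (F : T4Family) (D : Datum F N) (g₀ : ℕ → ℝ) (os : List (ULoop F)) (S : SpineCarriers), SRec F D g₀ os S ↔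
      ∃ (θ : Stage11Params F N) (hP : θ.Provisos₁₁), θ.Admissible ∧ D = datumOfRecord₁₁ F N θ hP ∧ S = cr F θ hP g₀ os) :
    S_N20 SRec ↔ ∀ (F : T4Family) (θ : Stage11Params F N) (hP : θ.Provisos₁₁), θ.Admissible → ∀ (g₀ : ℕ → ℝ) (os : List (ULoop F)),
      RelWeightBound (cr F θ hP g₀ os).l₀ (cr F θ hP g₀ os).T (cr F θ hP g₀ os).A (cr F θ hP g₀ os).B (cr F θ hP g₀ os).Bad
        (cr F θ hP g₀ os).W := by
  constructor
  · intro h F θ hP hθ g₀ os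
    exact h F (datumOfRecord₁₁ F N θ hP) g₀ os (cr F θ hP g₀ os) ((hkey F _ g₀ os _).mpr ⟨θ, hP, hθ, rfl, rfl⟩)
  · intro h F D g₀ os S hS
    obtain ⟨θ, hP, hθ, -, rfl⟩ := (hkey F D g₀ os S).mp hS
    exact h F θ hP hθ g₀ os

/-- **ONE-SIDED KEY suffices for the closer direction**: if every pinned bundle IS the reading of some admissible Stage-11 θ with provisos realising the datum
(the `→` half of the key), NE7b at every reading gives `S_N20 SRec`. [bookkeeping] -/
theorem s_N20_of_keyed₁₁ (SRec : SpineRecordPred N)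
    (hkey : ∀ (F : T4Family) (D : Datum F N) (g₀ : ℕ → ℝ) (os : List (ULoop F)) (S : SpineCarriers), SRec F D g₀ os S →
      ∃ (θ : Stage11Params F N) (hP : θ.Provisos₁₁), θ.Admissible ∧ D = datumOfRecord₁₁ F N θ hP ∧ S = cr F θ hP g₀ os)
    (h : ∀ (F : T4Family) (θ : Stage11Params F N) (hP : θ.Provisos₁₁), θ.Admissible → ∀ (g₀ : ℕ → ℝ) (os : List (ULoop F)),
      RelWeightBound (cr F θ hP g₀ os).l₀ (cr F θ hP g₀ os).T (cr F θ hP g₀ os).A (cr F θ hP g₀ os).B (cr F θ hP g₀ os).Bad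
        (cr F θ hP g₀ os).W) :
    S_N20 SRec := by
  intro F D g₀ os S hS
  obtain ⟨θ, hP, hθ, -, rfl⟩ := hkey F D g₀ os S hS
  exact h F θ hP hθ g₀ os

end Keyed

/-- **(W2) CLOSER — `S_N20 SRec` FOR EVERY SPINE-CARRIER PREDICATE TYPED OVER THE STAGE-11 RECORD WITH THE BOUND** (twin of n17-a's
`BalabanUVNodesN17.s_N17_of_stage9_slot`): if every bundle `S` of record for `(F, D, g₀, os)` comes with an admissible Stage-11 witness θ WITH ITS PROVISOS
realising `D` and NE7b's `RelWeightBound` at `S`'s own carriers, then `S_N20 SRec`.  The θ-witness is DISPLAYED, not used: N20 reads nothing of the datum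
(§1) — which is exactly why the ₁₁ objects can enter N20 only through a READING of the carriers (§2) or through the dictionary (§3). [bookkeeping] -/
theorem s_N20_of_stage11_slot (SRec : SpineRecordPred N)
    (hslot : ∀ (F : T4Family) (D : Datum F N) (g₀ : ℕ → ℝ) (os : List (ULoop F)) (S : SpineCarriers), SRec F D g₀ os S →
      ∃ (θ : Stage11Params F N) (hP : θ.Provisos₁₁), θ.Admissible ∧ D = datumOfRecord₁₁ F N θ hP ∧
        RelWeightBound S.l₀ S.T S.A S.B S.Bad S.W) :
    S_N20 SRec := by
  intro F D g₀ os S hS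
  obtain ⟨θ, hP, -, -, h⟩ := hslot F D g₀ os S hS
  exact h

/-! ## §2 The closers of p421432 RE-KEYED over NODE 00's Stage-11 parameter tuples (dag-n20-a's producers BY NAME) -/

section Closers

variable (cr : (F : T4Family) → (θ : Stage11Params F N) → θ.Provisos₁₁ → (ℕ → ℝ) → List (ULoop F) → SpineCarriers)

/-- **`S_N20` AT ₁₁ FROM TWO RUNS' EXTRACTION LAWS AT THE READING'S EXACT CARRIERS.**  At a predicate keyed at ₁₁ by `cr` (one-sided key): if for every
admissible Stage-11 θ with provisos and every `(g₀, os)` the reading `S := cr F θ hP g₀ os` carries the two runs' `PinnedExtraction.ExtractionLaws` over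
`S.T`, `S.Bad` (pinned classes, sub-classes, source-uniform quotients — the H3^NE7b display of (1.79)–(1.89)'s KIND), nonnegative weights, quotient totals
`≤ S.W K` in both runs, `S.W K < 1` and `Summable S.W`, then `S_N20 SRec` — `N20Knit.relWeightBound_of_extractionLaws` BY NAME at θ's reading.  (What the
₁₁ definer of `cr` must deliver for N20, row by row.) [bookkeeping] -/
theorem s_N20_keyed₁₁_of_extractionLaws (SRec : SpineRecordPred N)
    (hkey : ∀ (F : T4Family) (D : Datum F N) (g₀ : ℕ → ℝ) (os : List (ULoop F)) (S : SpineCarriers), SRec F D g₀ os S →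
      ∃ (θ : Stage11Params F N) (hP : θ.Provisos₁₁), θ.Admissible ∧ D = datumOfRecord₁₁ F N θ hP ∧ S = cr F θ hP g₀ os)
    (hrows : ∀ (F : T4Family) (θ : Stage11Params F N) (hP : θ.Provisos₁₁), θ.Admissible → ∀ (g₀ : ℕ → ℝ) (os : List (ULoop F)),
      ∃ (α α' : Type) (X : ℕ → Finset α) (Badx : ℕ → α → Finset (cr F θ hP g₀ os).ι) (q : ℕ → α → ℝ)
        (X' : ℕ → Finset α') (Badx' : ℕ → α' → Finset (cr F θ hP g₀ os).ι) (q' : ℕ → α' → ℝ),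
        ExtractionLaws (cr F θ hP g₀ os).l₀ (cr F θ hP g₀ os).T (cr F θ hP g₀ os).A (cr F θ hP g₀ os).Bad X Badx q ∧
        ExtractionLaws (cr F θ hP g₀ os).l₀ (cr F θ hP g₀ os).T (cr F θ hP g₀ os).B (cr F θ hP g₀ os).Bad X' Badx' q' ∧
        (∀ (K : ℕ) (t : ℝ), |t| ≤ (cr F θ hP g₀ os).l₀ → ∀ τ, 0 ≤ (cr F θ hP g₀ os).A K t τ) ∧
        (∀ (K : ℕ) (t : ℝ), |t| ≤ (cr F θ hP g₀ os).l₀ → ∀ τ, 0 ≤ (cr F θ hP g₀ os).B K t τ) ∧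
        (∀ K, ∑ x ∈ X K, q K x ≤ (cr F θ hP g₀ os).W K) ∧ (∀ K, ∑ x ∈ X' K, q' K x ≤ (cr F θ hP g₀ os).W K) ∧
        (∀ K, (cr F θ hP g₀ os).W K < 1) ∧ Summable (cr F θ hP g₀ os).W) :
    S_N20 SRec := by
  refine s_N20_of_keyed₁₁ cr SRec hkey fun F θ hP hθ g₀ os => ?_
  obtain ⟨α, α', X, Badx, q, X', Badx', q', hA, hB, hA0, hB0, hWA, hWB, h1, hs⟩ := hrows F θ hP hθ g₀ os
  exact relWeightBound_of_extractionLaws hA hB hA0 hB0 hWA hWB h1 hs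

/-- **`S_N20` AT ₁₁ UNDER THE TWO-RATE MAJORANT.**  As `s_N20_keyed₁₁_of_extractionLaws` with the COUNT in two-rate currency — quotient totals
`≤ V·r^{K − j⋆(K)}` in both runs, `0 < r < 1`, `0 ≤ V`, a positive fraction `c·K ≤ K − j⋆(K)` of old steps, `V·r^{K − j⋆(K)} < 1` at every `K` — and the
reading's slot `(cr F θ hP g₀ os).W = (K ↦ V·r^{K − j⋆(K)})` (letters may depend on θ, `g₀`, `os`): `N20Knit.relWeightBound_of_extractionLaws_majorant` BY NAME.
[bookkeeping] -/
theorem s_N20_keyed₁₁_of_majorant (SRec : SpineRecordPred N)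
    (hkey : ∀ (F : T4Family) (D : Datum F N) (g₀ : ℕ → ℝ) (os : List (ULoop F)) (S : SpineCarriers), SRec F D g₀ os S →
      ∃ (θ : Stage11Params F N) (hP : θ.Provisos₁₁), θ.Admissible ∧ D = datumOfRecord₁₁ F N θ hP ∧ S = cr F θ hP g₀ os)
    (hrows : ∀ (F : T4Family) (θ : Stage11Params F N) (hP : θ.Provisos₁₁), θ.Admissible → ∀ (g₀ : ℕ → ℝ) (os : List (ULoop F)),
      ∃ (α α' : Type) (X : ℕ → Finset α) (Badx : ℕ → α → Finset (cr F θ hP g₀ os).ι) (q : ℕ → α → ℝ)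
        (X' : ℕ → Finset α') (Badx' : ℕ → α' → Finset (cr F θ hP g₀ os).ι) (q' : ℕ → α' → ℝ) (r V c : ℝ) (jstar : ℕ → ℕ),
        ExtractionLaws (cr F θ hP g₀ os).l₀ (cr F θ hP g₀ os).T (cr F θ hP g₀ os).A (cr F θ hP g₀ os).Bad X Badx q ∧
        ExtractionLaws (cr F θ hP g₀ os).l₀ (cr F θ hP g₀ os).T (cr F θ hP g₀ os).B (cr F θ hP g₀ os).Bad X' Badx' q' ∧
        (∀ (K : ℕ) (t : ℝ), |t| ≤ (cr F θ hP g₀ os).l₀ → ∀ τ, 0 ≤ (cr F θ hP g₀ os).A K t τ) ∧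
        (∀ (K : ℕ) (t : ℝ), |t| ≤ (cr F θ hP g₀ os).l₀ → ∀ τ, 0 ≤ (cr F θ hP g₀ os).B K t τ) ∧
        0 < r ∧ r < 1 ∧ 0 ≤ V ∧ 0 < c ∧ (∀ K : ℕ, c * K ≤ ((K - jstar K : ℕ) : ℝ)) ∧
        (∀ K, ∑ x ∈ X K, q K x ≤ V * r ^ (K - jstar K)) ∧ (∀ K, ∑ x ∈ X' K, q' K x ≤ V * r ^ (K - jstar K)) ∧
        (∀ K, V * r ^ (K - jstar K) < 1) ∧ (cr F θ hP g₀ os).W = fun K => V * r ^ (K - jstar K)) :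
    S_N20 SRec := by
  refine s_N20_of_keyed₁₁ cr SRec hkey fun F θ hP hθ g₀ os => ?_
  obtain ⟨α, α', X, Badx, q, X', Badx', q', r, V, c, jstar, hA, hB, hA0, hB0, h0, hr1, hV, hc, hfrac, hmajA, hmajB, hlt, hW⟩ :=
    hrows F θ hP hθ g₀ os
  rw [hW]
  exact relWeightBound_of_extractionLaws_majorant hA hB hA0 hB0 h0 hr1 hV hc hfrac hmajA hmajB hlt

/-- **`S_N20` AT ₁₁ FOR A WEIGHT-SLOT READING.**  If at every admissible Stage-11 θ with provisos the reading carries NE7b with SOME witness weight `W′`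
dominated by its slot (`W′ K ≤ (cr …).W K`), the slot `< 1` and summable, and termwise nonnegative weights on the classes, then `S_N20 SRec` —
`N20Knit.relWeightBound_mono_weight` BY NAME (the slot of record is a pinned majorant of what a witness road delivers). [bookkeeping] -/
theorem s_N20_keyed₁₁_of_weightSlot (SRec : SpineRecordPred N)
    (hkey : ∀ (F : T4Family) (D : Datum F N) (g₀ : ℕ → ℝ) (os : List (ULoop F)) (S : SpineCarriers), SRec F D g₀ os S →
      ∃ (θ : Stage11Params F N) (hP : θ.Provisos₁₁), θ.Admissible ∧ D = datumOfRecord₁₁ F N θ hP ∧ S = cr F θ hP g₀ os)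
    (hrows : ∀ (F : T4Family) (θ : Stage11Params F N) (hP : θ.Provisos₁₁), θ.Admissible → ∀ (g₀ : ℕ → ℝ) (os : List (ULoop F)),
      ∃ W' : ℕ → ℝ,
        RelWeightBound (cr F θ hP g₀ os).l₀ (cr F θ hP g₀ os).T (cr F θ hP g₀ os).A (cr F θ hP g₀ os).B (cr F θ hP g₀ os).Bad W' ∧
        (∀ K, W' K ≤ (cr F θ hP g₀ os).W K) ∧ (∀ K, (cr F θ hP g₀ os).W K < 1) ∧ Summable (cr F θ hP g₀ os).W ∧
        (∀ (K : ℕ) (t : ℝ), |t| ≤ (cr F θ hP g₀ os).l₀ → ∀ τ ∈ (cr F θ hP g₀ os).T K, 0 ≤ (cr F θ hP g₀ os).A K t τ) ∧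
        (∀ (K : ℕ) (t : ℝ), |t| ≤ (cr F θ hP g₀ os).l₀ → ∀ τ ∈ (cr F θ hP g₀ os).T K, 0 ≤ (cr F θ hP g₀ os).B K t τ)) :
    S_N20 SRec := by
  refine s_N20_of_keyed₁₁ cr SRec hkey fun F θ hP hθ g₀ os => ?_
  obtain ⟨W', hW', hle, h1, hs, hA, hB⟩ := hrows F θ hP hθ g₀ os
  exact relWeightBound_mono_weight hW' hle h1 hs hA hB

end Closers

/-! ## §3 Where the ₁₁ objects enter N20: the E1∕E2 dictionary at the Stage-11 datum `datumOfRecord₁₁ F N θ hP` -/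

section Dictionary

variable {F : T4Family}

/-- **THE DRESSED PARTITION FUNCTIONS OF A STAGE-11 DATUM ARE POSITIVE — no hypothesis.**  For every Stage-11 parameter tuple θ with provisos, every bare
sequence `g₀`, loop string `os`, cutoff `K` and source `t`: `0 < schemeZ ((datumOfRecord₁₁ F N θ hP).scheme g₀) os K t` (binder B1 at the ₁₁ datum,
`Node00.isPrintedAveraged_datumOfRecord₁₁`, gives measurable averaging maps; then n27-a's `schemeZ_scheme_pos`: ferromagnetic Wilson weight, `1`-bounded
measurable observables).  So at ₁₁ the left side of the E1∕E2 dictionary is a genuine positive number built from the densities of record `densOfRecord₁₀`.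
[bookkeeping] -/
theorem schemeZ_pos_datumOfRecord₁₁ (θ : Stage11Params F N) (hP : θ.Provisos₁₁) (g₀ : ℕ → ℝ) (os : List (ULoop F)) (K : ℕ) (t : ℝ) :
    0 < T4GenFunBounds.schemeZ ((datumOfRecord₁₁ F N θ hP).scheme g₀) os K t :=
  schemeZ_scheme_pos (datumOfRecord₁₁ F N θ hP) (Node00.isPrintedAveraged_datumOfRecord₁₁ F N θ hP).avgMeasurable g₀ os K t

/-- **NE7b AS THE ₁₁ SENTENCE, run A.**  If a bundle `S` pinned at the Stage-11 datum of θ satisfies run A's dictionary E1 there (its class sums ARE the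
dressed partition functions of the string after `S.K₀ + K` steps on `|t| ≤ S.l₀`, the `S_N27x` clause) and NE7b's `RelWeightBound`, then at every cutoff
and source the PERSISTENT-ACTIVITY CLASSES CARRY AT MOST THE FRACTION `S.W K` OF THE STRING'S DRESSED PARTITION FUNCTION OF RECORD:
`Σ_{τ ∈ S.Bad K t} S.A K t τ ≤ S.W K · schemeZ ((datumOfRecord₁₁ F N θ hP).scheme g₀) os (S.K₀ + K) t`. [bookkeeping] -/
theorem badWeight_le_schemeZ_datumOfRecord₁₁_left (θ : Stage11Params F N) (hP : θ.Provisos₁₁) (g₀ : ℕ → ℝ) (os : List (ULoop F))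
    (S : SpineCarriers)
    (hE1 : ∀ (K : ℕ) (t : ℝ), |t| ≤ S.l₀ →
      T4GenFunBounds.schemeZ ((datumOfRecord₁₁ F N θ hP).scheme g₀) os (S.K₀ + K) t = ∑ τ ∈ S.T K, S.A K t τ)
    (h20 : RelWeightBound S.l₀ S.T S.A S.B S.Bad S.W) (K : ℕ) (t : ℝ) (ht : |t| ≤ S.l₀) :
    ∑ τ ∈ S.Bad K t, S.A K t τ ≤ S.W K * T4GenFunBounds.schemeZ ((datumOfRecord₁₁ F N θ hP).scheme g₀) os (S.K₀ + K) t := by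
  rw [hE1 K t ht]
  exact h20.bad_left K t ht

/-- **NE7b AS THE ₁₁ SENTENCE, run B** (dictionary E2: class sums = the dressed partition functions after `S.K₀ + K + 1` steps). [bookkeeping] -/
theorem badWeight_le_schemeZ_datumOfRecord₁₁_right (θ : Stage11Params F N) (hP : θ.Provisos₁₁) (g₀ : ℕ → ℝ) (os : List (ULoop F))
    (S : SpineCarriers)
    (hE2 : ∀ (K : ℕ) (t : ℝ), |t| ≤ S.l₀ →
      T4GenFunBounds.schemeZ ((datumOfRecord₁₁ F N θ hP).scheme g₀) os (S.K₀ + K + 1) t = ∑ τ ∈ S.T K, S.B K t τ)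
    (h20 : RelWeightBound S.l₀ S.T S.A S.B S.Bad S.W) (K : ℕ) (t : ℝ) (ht : |t| ≤ S.l₀) :
    ∑ τ ∈ S.Bad K t, S.B K t τ ≤ S.W K * T4GenFunBounds.schemeZ ((datumOfRecord₁₁ F N θ hP).scheme g₀) os (S.K₀ + K + 1) t := by
  rw [hE2 K t ht]
  exact h20.bad_right K t ht

/-- **THE GOOD CLASSES ARE PROPER AT A STAGE-11 DATUM.**  Under E1 at the ₁₁ datum and NE7b, the GOOD part `S.T K ∖ S.Bad K t` carries POSITIVE total weight
at every cutoff and `|t| ≤ S.l₀` — n27-a's `goodTotal_pos_of_E1` BY NAME, its hypothesis `D.AvgMeasurable` DISCHARGED at ₁₁ by B1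
(`Node00.isPrintedAveraged_datumOfRecord₁₁`). [bookkeeping] -/
theorem goodTotal_pos_datumOfRecord₁₁ (θ : Stage11Params F N) (hP : θ.Provisos₁₁) (g₀ : ℕ → ℝ) (os : List (ULoop F)) (S : SpineCarriers)
    (hE1 : ∀ (K : ℕ) (t : ℝ), |t| ≤ S.l₀ →
      T4GenFunBounds.schemeZ ((datumOfRecord₁₁ F N θ hP).scheme g₀) os (S.K₀ + K) t = ∑ τ ∈ S.T K, S.A K t τ)
    (h20 : RelWeightBound S.l₀ S.T S.A S.B S.Bad S.W) (K : ℕ) {t : ℝ} (ht : |t| ≤ S.l₀) :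
    letI := S.dec; 0 < ∑ τ ∈ S.T K \ S.Bad K t, S.A K t τ := by
  letI := S.dec
  exact goodTotal_pos_of_E1 (datumOfRecord₁₁ F N θ hP) (Node00.isPrintedAveraged_datumOfRecord₁₁ F N θ hP).avgMeasurable g₀ os hE1 h20 K ht

/-- **AN E1-PINNED BUNDLE AT A STAGE-11 DATUM IS NEVER THE EMPTY EXPANSION** (`0 ≤ S.l₀`): every term class `S.T K` is nonempty — n27-a's
`classes_nonempty_of_E1` BY NAME with `D.AvgMeasurable` discharged at ₁₁.  Consequence for the ₁₁ definer of the spine carriers: of p421432's guards the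
vacuity-by-emptiness reading cannot arise once E1 is pinned at the datum; the bad-class traps (`s_N20_of_noBadReading`, the saturated refutation
`not_s_N20_of_admits_saturated`) are the ones to honour. [bookkeeping] -/
theorem classes_nonempty_datumOfRecord₁₁ (θ : Stage11Params F N) (hP : θ.Provisos₁₁) (g₀ : ℕ → ℝ) (os : List (ULoop F)) (S : SpineCarriers)
    (hl₀ : 0 ≤ S.l₀)
    (hE1 : ∀ (K : ℕ) (t : ℝ), |t| ≤ S.l₀ →
      T4GenFunBounds.schemeZ ((datumOfRecord₁₁ F N θ hP).scheme g₀) os (S.K₀ + K) t = ∑ τ ∈ S.T K, S.A K t τ)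
    (K : ℕ) : (S.T K).Nonempty :=
  classes_nonempty_of_E1 (datumOfRecord₁₁ F N θ hP) (Node00.isPrintedAveraged_datumOfRecord₁₁ F N θ hP).avgMeasurable g₀ os hl₀ hE1 K

end Dictionary

/-! ## §4 Non-vacuity of the ₁₁-typed stub ⟺ the body of K0 (`Record11Inhabited`) at `N`; the consumer face at a Stage-11 record pair -/

/-- **IF THE STAGE-11 RECORD CLASS IS EMPTY, `S_N20` AT ₁₁ IS FREE.**  If on no family an admissible Stage-11 parameter tuple satisfies its displayed provisos
(the NEGATION of K0's body at `N`), a spine-carrier predicate typed over ₁₁C pins no bundle at all, and `S_N20 SRec` holds with no estimate —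
`N20AtSpineCarriers.s_N20_of_empty` BY NAME.  (Located vacuity: the ₁₁ knit is worth exactly as much as K0.) [bookkeeping] -/
theorem s_N20_keyed₁₁_of_uninhabited (SRec : SpineRecordPred N)
    (htyped : ∀ (F : T4Family) (D : Datum F N) (g₀ : ℕ → ℝ) (os : List (ULoop F)) (S : SpineCarriers), SRec F D g₀ os S →
      ∃ (θ : Stage11Params F N) (hP : θ.Provisos₁₁), θ.Admissible ∧ D = datumOfRecord₁₁ F N θ hP)
    (hempty : ∀ (F : T4Family) (θ : Stage11Params F N), θ.Admissible → ¬ θ.Provisos₁₁) :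
    S_N20 SRec :=
  s_N20_of_empty SRec fun F D g₀ os S hS => by
    obtain ⟨θ, hP, hθ, -⟩ := htyped F D g₀ os S hS
    exact hempty F θ hθ hP

section KeyedAtRecord

variable (cr : (F : T4Family) → (θ : Stage11Params F N) → θ.Provisos₁₁ → (ℕ → ℝ) → List (ULoop F) → SpineCarriers)

/-- **UNDER K0's BODY THE ₁₁-KEYED STUB IS NOT THE EMPTY IMPLICATION.**  If the Stage-11 record class is inhabited on every family
(`∀ F, ∃ D w, Node00.IsRecordOfRecord₁₁C F N D w` — the body of the route's K0 `Record11Inhabited` at `N`; an antecedent here, neither proved nor assumed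
elsewhere), then a predicate keyed at ₁₁ by ANY reading `cr` pins, on every family and for every `(g₀, os)`, at least one bundle at a Stage-11 datum of
record (`Node00.exists_provisos_of_isRecordOfRecord₁₁C`). [bookkeeping] -/
theorem exists_pinned_keyed₁₁_of_inhabited (SRec : SpineRecordPred N)
    (hkey : ∀ (F : T4Family) (D : Datum F N) (g₀ : ℕ → ℝ) (os : List (ULoop F)) (S : SpineCarriers), SRec F D g₀ os S ↔
      ∃ (θ : Stage11Params F N) (hP : θ.Provisos₁₁), θ.Admissible ∧ D = datumOfRecord₁₁ F N θ hP ∧ S = cr F θ hP g₀ os)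
    (hK0 : ∀ F : T4Family, ∃ (D : Datum F N) (w : DagBinding.WorldP), IsRecordOfRecord₁₁C F N D w)
    (F : T4Family) (g₀ : ℕ → ℝ) (os : List (ULoop F)) :
    ∃ (D : Datum F N) (w : DagBinding.WorldP) (S : SpineCarriers), IsRecordOfRecord₁₁C F N D w ∧ SRec F D g₀ os S := by
  obtain ⟨D, w, hR⟩ := hK0 F
  obtain ⟨θ, hP, hθ, hD⟩ := Node00.exists_provisos_of_isRecordOfRecord₁₁C hR
  exact ⟨D, w, cr F θ hP g₀ os, hR, (hkey F D g₀ os _).mpr ⟨θ, hP, hθ, hD, rfl⟩⟩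

/-- **THE CONSUMER FACE AT A STAGE-11 RECORD PAIR.**  At a predicate keyed at ₁₁ by `cr` with `S_N20 SRec`: every Stage-11 record pair `(D, w)` comes with an
admissible θ with provisos realising `D`, and for every `(g₀, os)` the bundle `cr F θ hP g₀ os` IS PINNED AT THE PAIR'S OWN DATUM and carries NE7b there — the
N20 conjunct the ₁₁ join of N27 (`YMDAG.UVSplit.SpineMatching_of` ∕ XII `spine_of_coreEdge` at `Rec := IsRecordOfRecord₁₁C F N`) consumes next to the
extraction stub `S_N27x`'s pinned bundle. [bookkeeping] -/
theorem relWeightBound_keyed₁₁_of_isRecordOfRecord₁₁C (SRec : SpineRecordPred N)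
    (hkey : ∀ (F : T4Family) (D : Datum F N) (g₀ : ℕ → ℝ) (os : List (ULoop F)) (S : SpineCarriers), SRec F D g₀ os S ↔
      ∃ (θ : Stage11Params F N) (hP : θ.Provisos₁₁), θ.Admissible ∧ D = datumOfRecord₁₁ F N θ hP ∧ S = cr F θ hP g₀ os)
    (h : S_N20 SRec) {F : T4Family} {D : Datum F N} {w : DagBinding.WorldP} (hR : IsRecordOfRecord₁₁C F N D w) :
    ∃ (θ : Stage11Params F N) (hP : θ.Provisos₁₁), θ.Admissible ∧ D = datumOfRecord₁₁ F N θ hP ∧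
      ∀ (g₀ : ℕ → ℝ) (os : List (ULoop F)), SRec F D g₀ os (cr F θ hP g₀ os) ∧
        RelWeightBound (cr F θ hP g₀ os).l₀ (cr F θ hP g₀ os).T (cr F θ hP g₀ os).A (cr F θ hP g₀ os).B (cr F θ hP g₀ os).Bad
          (cr F θ hP g₀ os).W := by
  obtain ⟨θ, hP, hθ, hD⟩ := Node00.exists_provisos_of_isRecordOfRecord₁₁C hR
  refine ⟨θ, hP, hθ, hD, fun g₀ os => ?_⟩
  have hS : SRec F D g₀ os (cr F θ hP g₀ os) := (hkey F D g₀ os _).mpr ⟨θ, hP, hθ, hD, rfl⟩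
  exact ⟨hS, h F D g₀ os _ hS⟩

/-! ## §5 The shadow: the same reading keyed to def-T's ₅C shadow datum gives the same `S_N20` -/

/-- **N20 IS INVARIANT UNDER RE-KEYING TO THE ₅C SHADOW.**  Key the SAME reading `cr` once at the Stage-11 datum `datumOfRecord₁₁ F N θ hP` (`SRec₁₁`) and
once at def-T's ₅C SHADOW datum `datumOfRecord₅ F N (shadow₅OfRecord₁₁ F N θ hP γ')` of the same θ at any interval letter `γ'` (`SRec₅` — `Record11` §8:
the shadow has the same `C`, `dens`, `βfun`, `av`, and «`IsRecordOfRecord₁₁C → IsRecordOfRecord₅C` holds AT THE SHADOW, not at `D`»).  Then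
`S_N20 SRec₁₁ ↔ S_N20 SRec₅`: both pin the same SET of bundles (§1 `s_N20_of_image` twice).  So along n27-a's shadow road
(`Node00.exists_isRecordOfRecord₅C_of_isRecordOfRecord₁₁C`, XVI `spine_of_shadow`) the N20 conjunct needs no congruence lemma at all. [bookkeeping] -/
theorem s_N20_keyed₁₁_iff_shadow₅ (SRec₁₁ SRec₅ : SpineRecordPred N)
    (hkey₁₁ : ∀ (F : T4Family) (D : Datum F N) (g₀ : ℕ → ℝ) (os : List (ULoop F)) (S : SpineCarriers), SRec₁₁ F D g₀ os S ↔
      ∃ (θ : Stage11Params F N) (hP : θ.Provisos₁₁), θ.Admissible ∧ D = datumOfRecord₁₁ F N θ hP ∧ S = cr F θ hP g₀ os)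
    (hkey₅ : ∀ (F : T4Family) (D : Datum F N) (g₀ : ℕ → ℝ) (os : List (ULoop F)) (S : SpineCarriers), SRec₅ F D g₀ os S ↔
      ∃ (θ : Stage11Params F N) (hP : θ.Provisos₁₁) (γ' : ℝ), θ.Admissible ∧
        D = Node00.datumOfRecord₅ F N (Node00.shadow₅OfRecord₁₁ F N θ hP γ') ∧ S = cr F θ hP g₀ os) :
    S_N20 SRec₁₁ ↔ S_N20 SRec₅ := by
  constructor
  · refine fun h => s_N20_of_image (fun S ⟨F, D, g₀, os, hS⟩ => ?_) h
    obtain ⟨θ, hP, γ', hθ, -, rfl⟩ := (hkey₅ F D g₀ os S).mp hS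
    exact ⟨F, _, g₀, os, (hkey₁₁ F _ g₀ os _).mpr ⟨θ, hP, hθ, rfl, rfl⟩⟩
  · refine fun h => s_N20_of_image (fun S ⟨F, D, g₀, os, hS⟩ => ?_) h
    obtain ⟨θ, hP, hθ, -, rfl⟩ := (hkey₁₁ F D g₀ os S).mp hS
    exact ⟨F, _, g₀, os, (hkey₅ F _ g₀ os _).mpr ⟨θ, hP, 0, hθ, rfl, rfl⟩⟩

end KeyedAtRecord

end Summit.QuantumFields.YangMills.Theorems.N20AtRecord11
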